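import Mathlib.LinearAlgebra.TensorProduct.Basic
import Mathlib.Algebra.DirectSum.Module
import Mathlib.Algebra.Order.Antidiag.Prod
import Mathlib.Algebra.BigOperators.Group.Finset.Sigma
import Mathlib.Data.Finset.NatAntidiagonal
import HarnessLib

/-!
# Künneth components, bookkeeping II: from the direct-sum shape `⨁_{i+j=n} Hⁱ ⊗ Hʲ ≅ Hⁿ` to antidiagonal families

Layer `Literature/Algebra/Homology` (pure linear algebra, Mathlib only; THEOREMS only). Cell `hodgecm-mathlib`, F-11 sub-line
P1b, brick (G3) «Künneth on the product cover», ASSEMBLY (B-p21 (g21), second hand under F0P1b-p04 (g0)).  The Künneth map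
of the product cover arrives (★ `KunnethDirectSum.kunnethLinearEquiv` ≫ F-K3 `bijective_homologyMap_tensor_cross` ≫ the
product-cover identification (B-i)) as a BIJECTIVE linear map
`Φ : (⨁ (p : {p : ℤ × ℤ // p.1 + p.2 = n}), H^{p.1} ⊗ H^{p.2}) → HSⁿ` on the `ℤ × ℤ`-indexed direct sum (negative degrees being
zero), with known values on the summands `p = (a, b)`, `a b : ℕ` (the (B-ii) identity `Φ (ι_{a,b} (y ⊗ z)) = c_{a,b} (y ⊗ z)`).
The consumer (★ `KunnethComponentsBookkeeping`, hence ★ J3 `cup_one_one_surjective`) wants FAMILIES `T : ∀ p : ℕ × ℕ, H^{p.1} ⊗ H^{p.2}`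
summed over `Finset.antidiagonal n`.  This file is that translation:

* `toDirectSum` — `Ψ T = ∑_{p ∈ antidiagonal n} ι_{(p.1, p.2)} (T p)` (as a plain sum; no new definition is exported, the sum is
  spelled out in every statement); `apply_sum_lof_eq_sum_components` (`Φ (Ψ T) = ∑_p c_p (T p)`);
* `sum_lof_apply_idx` (the component of `Ψ T` at `(a, b)` is `T (a, b)`), `eq_zero_of_sum_lof_eq_zero` (`Ψ` injective);
* `exists_family_eq_of_nonneg` (`Ψ` surjective when the negative-degree summands vanish);
* **`hinjT_of_bijective`**, **`hsurjT_of_bijective`** — the T-shape injectivity ∕ surjectivity of `T ↦ ∑_p c_p (T p)`.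

HC_CM is proved only modulo the 7 printed citations until rung 0 closes — nothing here bears on a summit statement.

## References
* [Weibel1994] C. A. Weibel, *An introduction to homological algebra* (1994), Thm. 3.6.3 (Künneth formula over a field).
* [GortzWedhorn2023] U. Görtz, T. Wedhorn, *Algebraic Geometry II* (2023), Cor. 22.110 (Künneth formula for coherent cohomology).
-/

open scoped TensorProduct DirectSum
open Finset

namespace Literature.Algebra.Homology

namespace KunnethComponents

variable {k : Type*} [CommRing k] {HZ : ℤ → Type*} [∀ i, AddCommGroup (HZ i)] [∀ i, Module k (HZ i)]
  {HS : Type*} [AddCommGroup HS] [Module k HS] (n : ℕ)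

/-- The index of the `ℤ × ℤ`-direct sum corresponding to a pair of natural numbers on the antidiagonal of `n`.
[cite: Weibel1994, Thm. 3.6.3] -/
theorem natPair_mem_idx {p : ℕ × ℕ} (h : p.1 + p.2 = n) : ((p.1 : ℤ), (p.2 : ℤ)).1 + ((p.1 : ℤ), (p.2 : ℤ)).2 = (n : ℤ) := by
  push_cast [← h]; rfl

/-- The index map `p ↦ (p.1, p.2)` from the antidiagonal is injective. [cite: Weibel1994, Thm. 3.6.3] -/
theorem idx_injective {p q : ℕ × ℕ} (hp : p.1 + p.2 = n) (hq : q.1 + q.2 = n)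
    (h : (⟨((p.1 : ℤ), (p.2 : ℤ)), natPair_mem_idx n hp⟩ : {r : ℤ × ℤ // r.1 + r.2 = n}) =
      ⟨((q.1 : ℤ), (q.2 : ℤ)), natPair_mem_idx n hq⟩) : p = q := by
  have h1 := congrArg (fun r : {r : ℤ × ℤ // r.1 + r.2 = n} => r.1) h
  simp only [Prod.mk.injEq, Nat.cast_inj] at h1
  exact Prod.ext h1.1 h1.2

variable (Φ : (⨁ (r : {r : ℤ × ℤ // r.1 + r.2 = n}), HZ r.1.1 ⊗[k] HZ r.1.2) →ₗ[k] HS)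
  (c : ∀ p : ℕ × ℕ, p.1 + p.2 = n → HZ p.1 ⊗[k] HZ p.2 →ₗ[k] HS)
  (hc : ∀ (p : ℕ × ℕ) (h : p.1 + p.2 = n) (x : HZ p.1 ⊗[k] HZ p.2),
    Φ (DirectSum.lof k _ (fun r : {r : ℤ × ℤ // r.1 + r.2 = n} => HZ r.1.1 ⊗[k] HZ r.1.2)
      ⟨((p.1 : ℤ), (p.2 : ℤ)), natPair_mem_idx n h⟩ x) = c p h x)

include hc in
/-- **`Φ (∑_p ι_p (T p)) = ∑_p c_p (T p)`** (linearity + the values of `Φ` on the summands).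
[cite: Weibel1994, Thm. 3.6.3] -/
theorem apply_sum_lof_eq_sum_components (T : ∀ p : ℕ × ℕ, HZ p.1 ⊗[k] HZ p.2) :
    Φ (∑ p ∈ antidiagonal n, if h : p.1 + p.2 = n then
      DirectSum.lof k _ (fun r : {r : ℤ × ℤ // r.1 + r.2 = n} => HZ r.1.1 ⊗[k] HZ r.1.2)
        ⟨((p.1 : ℤ), (p.2 : ℤ)), natPair_mem_idx n h⟩ (T p) else 0) =
      ∑ p ∈ antidiagonal n, if h : p.1 + p.2 = n then c p h (T p) else 0 := by
  rw [map_sum]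
  refine Finset.sum_congr rfl fun p hp => ?_
  have hpn : p.1 + p.2 = n := mem_antidiagonal.mp hp
  rw [dif_pos hpn, dif_pos hpn, hc]

/-- **The component of `∑_p ι_p (T p)` at the index of `q` is `T q`.** [cite: Weibel1994, Thm. 3.6.3] -/
theorem sum_lof_apply_idx (T : ∀ p : ℕ × ℕ, HZ p.1 ⊗[k] HZ p.2) {q : ℕ × ℕ} (hq : q.1 + q.2 = n) :
    DirectSum.component k _ (fun r : {r : ℤ × ℤ // r.1 + r.2 = n} => HZ r.1.1 ⊗[k] HZ r.1.2)
      ⟨((q.1 : ℤ), (q.2 : ℤ)), natPair_mem_idx n hq⟩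
      (∑ p ∈ antidiagonal n, if h : p.1 + p.2 = n then
        DirectSum.lof k _ (fun r : {r : ℤ × ℤ // r.1 + r.2 = n} => HZ r.1.1 ⊗[k] HZ r.1.2)
          ⟨((p.1 : ℤ), (p.2 : ℤ)), natPair_mem_idx n h⟩ (T p) else 0) = T q := by
  classical
  rw [map_sum, Finset.sum_eq_single q]
  · rw [dif_pos hq, DirectSum.component.lof_self]
  · intro p hp hpq
    have hpn : p.1 + p.2 = n := mem_antidiagonal.mp hp
    rw [dif_pos hpn, DirectSum.component.of, dif_neg]
    exact fun h => hpq (idx_injective n hpn hq h)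
  · intro h
    exact absurd (mem_antidiagonal.mpr hq) h

/-- **`Ψ : T ↦ ∑_p ι_p (T p)` is injective**: if the sum vanishes, every component on the antidiagonal vanishes.
[cite: Weibel1994, Thm. 3.6.3] -/
theorem eq_zero_of_sum_lof_eq_zero (T : ∀ p : ℕ × ℕ, HZ p.1 ⊗[k] HZ p.2)
    (h0 : (∑ p ∈ antidiagonal n, if h : p.1 + p.2 = n then
      DirectSum.lof k _ (fun r : {r : ℤ × ℤ // r.1 + r.2 = n} => HZ r.1.1 ⊗[k] HZ r.1.2)
        ⟨((p.1 : ℤ), (p.2 : ℤ)), natPair_mem_idx n h⟩ (T p) else 0) = 0)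
    {q : ℕ × ℕ} (hq : q ∈ antidiagonal n) : T q = 0 := by
  have hqn : q.1 + q.2 = n := mem_antidiagonal.mp hq
  rw [← sum_lof_apply_idx n T hqn, h0, map_zero]

/-- **`Ψ` is surjective when the negative-degree summands vanish**: every element of the `ℤ × ℤ`-direct sum is a sum of
summands indexed by the antidiagonal of natural numbers. [cite: Weibel1994, Thm. 3.6.3] -/
theorem exists_family_eq_of_nonneg (hneg : ∀ i : ℤ, i < 0 → Subsingleton (HZ i))
    (X : ⨁ (r : {r : ℤ × ℤ // r.1 + r.2 = n}), HZ r.1.1 ⊗[k] HZ r.1.2) :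
    ∃ T : ∀ p : ℕ × ℕ, HZ p.1 ⊗[k] HZ p.2,
      (∑ p ∈ antidiagonal n, if h : p.1 + p.2 = n then
        DirectSum.lof k _ (fun r : {r : ℤ × ℤ // r.1 + r.2 = n} => HZ r.1.1 ⊗[k] HZ r.1.2)
          ⟨((p.1 : ℤ), (p.2 : ℤ)), natPair_mem_idx n h⟩ (T p) else 0) = X := by
  classical
  induction X using DirectSum.induction_on with
  | zero =>
    refine ⟨fun _ => 0, Finset.sum_eq_zero fun p _ => ?_⟩
    by_cases h : p.1 + p.2 = n
    · rw [dif_pos h, map_zero]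
    · rw [dif_neg h]
  | of r x =>
    obtain ⟨⟨i, j⟩, hr⟩ := r
    by_cases hi : 0 ≤ i
    · by_cases hj : 0 ≤ j
      · -- a summand indexed by natural numbers: take the family supported at `(i, j)`
        obtain ⟨a, rfl⟩ := Int.eq_ofNat_of_zero_le hi
        obtain ⟨b, rfl⟩ := Int.eq_ofNat_of_zero_le hj
        have hab : a + b = n := by
          have h' := hr
          simp only at h'
          exact_mod_cast h'
        refine ⟨fun p => if hp : p = (a, b) then cast (by rw [hp]) x else 0, ?_⟩
        rw [Finset.sum_eq_single (a, b)]
        · dsimp only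
          rw [dif_pos hab, dif_pos rfl, cast_eq]
          rfl
        · intro p _ hp
          dsimp only
          by_cases hpn : p.1 + p.2 = n
          · rw [dif_pos hpn, dif_neg hp, map_zero]
          · rw [dif_neg hpn]
        · intro h
          exact absurd (mem_antidiagonal.mpr hab) h
      · -- `j < 0`: the summand is zero
        haveI := hneg j (lt_of_not_ge hj)
        haveI : Subsingleton (HZ i ⊗[k] HZ j) := inferInstance
        refine ⟨fun _ => 0, ?_⟩
        rw [Subsingleton.elim x 0, map_zero]
        exact Finset.sum_eq_zero fun p _ => by
          by_cases h : p.1 + p.2 = n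
          · rw [dif_pos h, map_zero]
          · rw [dif_neg h]
    · haveI := hneg i (lt_of_not_ge hi)
      haveI : Subsingleton (HZ i ⊗[k] HZ j) := inferInstance
      refine ⟨fun _ => 0, ?_⟩
      rw [Subsingleton.elim x 0, map_zero]
      exact Finset.sum_eq_zero fun p _ => by
        by_cases h : p.1 + p.2 = n
        · rw [dif_pos h, map_zero]
        · rw [dif_neg h]
  | add X Y hX hY =>
    obtain ⟨T₁, h₁⟩ := hX
    obtain ⟨T₂, h₂⟩ := hY
    refine ⟨fun p => T₁ p + T₂ p, ?_⟩
    rw [← h₁, ← h₂, ← Finset.sum_add_distrib]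
    refine Finset.sum_congr rfl fun p _ => ?_
    by_cases h : p.1 + p.2 = n
    · rw [dif_pos h, dif_pos h, dif_pos h, map_add]
    · rw [dif_neg h, dif_neg h, dif_neg h, add_zero]

include hc in
/-- **INJECTIVITY in the T-shape**: if `Φ` is injective then `∑_{p ∈ antidiagonal n} c_p (T p) = 0` forces `T p = 0` on
the antidiagonal — the hypothesis `hinjT` of ★ `KunnethComponents.eq_zero_of_sum_components_eq_zero`.
[cite: Weibel1994, Thm. 3.6.3] [cite: GortzWedhorn2023, Cor. 22.110] -/
theorem hinjT_of_injective (hΦ : Function.Injective Φ) (T : ∀ p : ℕ × ℕ, HZ p.1 ⊗[k] HZ p.2)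
    (hT : (∑ p ∈ antidiagonal n, if h : p.1 + p.2 = n then c p h (T p) else 0) = 0)
    (q : ℕ × ℕ) (hq : q ∈ antidiagonal n) : T q = 0 := by
  rw [← apply_sum_lof_eq_sum_components n Φ c hc T] at hT
  have h0 := hΦ (hT.trans (map_zero Φ).symm)
  exact eq_zero_of_sum_lof_eq_zero n T h0 hq

include hc in
/-- **SURJECTIVITY in the T-shape**: if `Φ` is surjective and the negative-degree summands vanish, every `z ∈ HS` is
`∑_{p ∈ antidiagonal n} c_p (T p)` for some family `T` — the shape of ★ J3's `hsurj`. [cite: Weibel1994, Thm. 3.6.3] [cite: GortzWedhorn2023, Cor. 22.110] -/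
theorem hsurjT_of_surjective (hneg : ∀ i : ℤ, i < 0 → Subsingleton (HZ i)) (hΦ : Function.Surjective Φ) (z : HS) :
    ∃ T : ∀ p : ℕ × ℕ, HZ p.1 ⊗[k] HZ p.2,
      z = ∑ p ∈ antidiagonal n, if h : p.1 + p.2 = n then c p h (T p) else 0 := by
  obtain ⟨X, rfl⟩ := hΦ z
  obtain ⟨T, hT⟩ := exists_family_eq_of_nonneg n hneg X
  exact ⟨T, by rw [← apply_sum_lof_eq_sum_components n Φ c hc T, hT]⟩

end KunnethComponents

end Literature.Algebra.Homology
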